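import Mathlib
import HarnessLib
import Summits.ResolutionOfSingularities.ResolutionOfSingularities.Theorems.WildQuotientsWildQuotientResolutionS1PlanarFieldDefs
import Summits.ResolutionOfSingularities.ResolutionOfSingularities.Theorems.WildQuotientsWildQuotientResolutionS1KillExitDefs
import Summits.ResolutionOfSingularities.ResolutionOfSingularities.Theorems.WildQuotientsWildQuotientResolutionS1KillExitDefsTame
import Summits.ResolutionOfSingularities.ResolutionOfSingularities.Theorems.WildQuotientsWildQuotientResolutionSlices
import Summits.ResolutionOfSingularities.ResolutionOfSingularities.Theses.WildQuotients
import Literature.AlgebraicGeometry.Resolution.TameQuotientSingularitiesResolution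
/-!
# Line `s1a-tamebr` — skeleton of the crux `CyclicQuotientFourfolds` (stmt-ResolutionOfSingularities-17941), TAME/BR form

[OURS · L1 W4.5c] — NOT statements of the manuscript; counted 0 post-V5; AI-level planning, weaker than expert
review. CONDITIONAL TWIN of the line of record `s1a-logminvertex` (plan-1 RULING (L∨B) 2026-08-27T19:04:57Z):
same local game and the same named S1-residual `stub_W1N_print`; the EXIT brick is the tree's NAMED FACT
`Literature.AlgebraicGeometry.Resolution.BerghRydh2019_diagonalizableQuotientResolution` (Bergh–Rydh, arXiv:1905.00872,
Thm 5 with Thm 2; F-30 of the chain), carried as the NAMED-RESIDUAL stub `stub_berghRydh` — so this line is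
CONDITIONAL on F-30 exactly as the chain's `V-BR` specimen is; F-30 stays a hypothesis, never a fact, and is OUT of the
linear rung programme. Vocabulary: D1 `…S1PlanarFieldDefs` (p554319), D2 `…S1KillExitDefs` (p558072, LOG form) and D2-T
`…S1KillExitDefsTame` (idea-2 g15 draft 3feb385b4b4e1be8: `IsTameRootChart`, `LocallyTameRootRegular`, `KillTameModel`,
`GlobalKillTame`, `LocalKillTame`, `BRExitCover`, `KillBRModel`, `GlobalKillBR`).

THE LINE. The ADAPTED LOG-MIN-VERTEX GAME (idea-2 card P, K1′-adapted weights) run `G`-equivariantly UPSTAIRS on `X′`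
leaves at every leaf a Király–Lütkebohmert KILL on the regular `ℤ`-graded Rees chart `Spec B` (idea-2 REES KILL LEMMA R:
`I_Σ̃·B = I_σ̂·B + (μ−1)·B`, `cardM_g15/ReesKill.lean` 83f32b7de9ad3e71; plan-1 END-STATE ruling 18:36:23Z as amended
19:04:57Z (1)); hence the quotient `V/G` is covered by TAME ROOT CHARTS `Spec (B^G)₀` (`B^G` regular by
`KiralyLutkebohmertRegularity_holds`, `(B₀)^G = (B^G)₀`, norm units `N(x̄_c)`): `LocallyTameRootRegular (V/G)`,
an INTRINSIC end state meaningful for complete local models (`LocalKillTame`) and for schemes of finite type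
(`GlobalKillTame`). At the GLOBAL finite-type level ONLY (plan-1 (3): a Bergh–Rydh étale chart cannot exist over the
closed point of a complete local base — dead line (47) again) the tame root charts are converted into a Bergh–Rydh
exit cover (`GlobalKillBR`) by the tree's PROVED slice core (`exists_slice`, induced-torus trick,
`smooth_of_isRegular_of_perfectField`), and the named fact resolves `V/G`, hence `X₁`.

STUBS (6; sorries live ONLY here): `stub_W1N_print` (shared with line L) · `stub_localGameT` (HARDEST) ·
`stub_globaliseT` · `stub_tameToBR` · `stub_berghRydh` (NAMED RESIDUAL F-30) · `stub_exitAssemblyBR`; composition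
`CyclicQuotientFourfolds_of` is a real proof. Disproof used: `Cruxes/WildQuotientResolution/Disproof.lean` —
`withoutRegular_iff_resolutionOfSingularities` (regularity of `X′` is used: the local binder is a power-series ring),
`no_separable_residue_growth_of_prime_degree` (honoured: inertia dichotomy inside `stub_globaliseT`).
-/

namespace Summit.ResolutionOfSingularities.ResolutionOfSingularities.Cruxes.CyclicQuotientFourfolds.S1aTameBR

open Summit.ResolutionOfSingularities.ResolutionOfSingularities.Theorems.WildQuotientResolution
open Literature.AlgebraicGeometry.Resolution

/-- **Named S1-residual ⟨(W1-N)_p⟩** (shared with line `s1a-logminvertex`): Seidenberg-type reduction for planar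
vector fields in characteristic `p`, D1 normal form. AI-level proof of record W1N-CASCADE (three books); idea-1's
support cascade `S1W1NCascade` (MilnorFloor, IsolatedSucc, Transport, OStep proved; NStep, NTwoExit open).
[OURS · L1 W4.5c] -/
theorem stub_W1N_print : ∀ p : ℕ, p.Prime → S1.W1NPrint p := by
  sorry

/-- **HARDEST — local game, tame end state**: on every complete local model `Spec κ⟦x₁…x_n⟧`, `n ≤ 4`, `κ` perfect of
characteristic `p`, `σ` of order `p`, the K1′-adapted log-min-vertex game terminates and leaves a KILL-TAME model
(`S1.LocalKillTame p n`): pin P6 upstairs, `LocallyTameRootRegular` on the quotient. Named obligations: (α) torus-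
homogeneous re-basing on the Rees charts (M8, `unitDescent`); (E-a) at every leaf via LEMMA R + K–L in dimension
`n+1` (flagged sub-case `θ(s) ∉ (s)`); the UNITS clause from the chart units `N(x̄_c)` / `N(z)`; termination =
the chain's engine evidence (K1′-adapted runs) read chart by chart — UNVERIFIED re-basing. `(W1-N)_p` enters through
the planar-field step of the game. [OURS · L1 W4.5c] -/
theorem stub_localGameT :
    ∀ p : ℕ, p.Prime → S1.W1NPrint p → ∀ n : ℕ, n ≤ 4 → S1.LocalKillTame p n := by
  sorry

/-- **S1b, tame form**: the complete local KILL-TAME models glue / spread out to ONE equivariant model over `X′`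
(`S1.GlobalKillTame p`): canonicity or choice-tolerance of the weight filtration, spreading-out along positive-
dimensional strata, algebraisation of complete-local `G`-stable centres, Cohen structure at closed points, the two
inertia cases (trivial ⇒ `q` étale ⇒ regular chart, `m = 0`; full ⇒ the local binder). [OURS · L1 W4.5c] -/
theorem stub_globaliseT :
    ∀ p : ℕ, p.Prime → (∀ n : ℕ, n ≤ 4 → S1.LocalKillTame p n) → S1.GlobalKillTame p := by
  sorry

/-- **Tame ⇒ Bergh–Rydh cover (GLOBAL finite-type level only)**: a KILL-TAME model of a finite-type datum over the
perfect field `k` is a KILL-BR model — each tame root chart `A ≃ 𝒜 0 ⊂ B` receives `k` in degree `0`; `B` is finitely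
generated over `𝒜 0` (graded Noetherian + the UNITS clause: `𝒜 d = u_d • 𝒜 0` on the finite-index subgroup, finitely
many cosets, `𝒜 c · B` finitely generated — tri-2 (T2), budgeted HERE), hence of finite type and, being regular,
smooth over `k` (`smooth_of_isRegular_of_perfectField`); the induced-torus trick turns the `Π ZMod (r j)`-grading
into a `ℤ^m`-grading with the same degree-`0` part (regularity descends along the `μ`-torsor), and the PROVED slice
core `exists_slice` (`Theorems/WeightedInvariantDatumToEmbeddedQuotientSingularitiesSliceCore.lean`) yields, Zariski-
locally on `Spec (𝒜 0)`, an étale chart `Spec (𝒮 0) → Spec (𝒜 0)` with `S` smooth of finite type graded by a FINITE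
abelian group — the `BRExitCover` clause; composing with the open immersion of the chart. [OURS · L1 W4.5c] -/
theorem stub_tameToBR : ∀ p : ℕ, p.Prime → S1.GlobalKillTame p → S1.GlobalKillBR p := by
  sorry

/-- **NAMED RESIDUAL F-30** — Bergh–Rydh (arXiv:1905.00872) Thm 5 with Thm 2: finite-type integral separated schemes
over a perfect field with diagonalizable (tame) quotient singularities, presented étale-locally by degree-`0` parts of
smooth graded algebras, have a resolution by a projective birational morphism. The tree's NAMED FACT (unproved in
tree; referee-published). This stub makes the line CONDITIONAL on F-30; it is never to be «proved» here other than by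
formalising the paper. [OURS · L1 W4.5c] -/
theorem stub_berghRydh : BerghRydh2019_diagonalizableQuotientResolution := by
  sorry

/-- **S1c, BR form**: from the named fact and `S1.GlobalKillBR p` to `S1.CyclicQuotientAt p` — faithful case: the
KILL-BR model `V → X′`, its quotient `V/G` (integral, separated and of finite type over `k`: derived from the model
and the datum, tri-2 N1) carries a `BRExitCover`, so the fact gives `HasResolution (V/G)`; `V/G → X₁` is proper
birational (G2 `QuotientModel…ProperBirational`, `ActionOver.gluedDesc`) and resolutions compose with proper
birational maps (`ComponentGluing.Scheme.HasResolution.of_isBirational`); non-faithful case `ρ = 1` (`|G| = p`):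
`Slices.hasResolution_of_injective`. [OURS · L1 W4.5c] -/
theorem stub_exitAssemblyBR :
    BerghRydh2019_diagonalizableQuotientResolution →
      ∀ p : ℕ, p.Prime → S1.GlobalKillBR p → S1.CyclicQuotientAt p := by
  sorry

/-- **Composition (real proof)**: the six stubs imply the crux `CyclicQuotientFourfolds` BY NAME
(`CyclicQuotientFourfolds ↔ ∀ p, p.Prime → S1.CyclicQuotientAt p` is `Iff.rfl`). -/
theorem CyclicQuotientFourfolds_of
    (hW : ∀ p : ℕ, p.Prime → S1.W1NPrint p)
    (hL : ∀ p : ℕ, p.Prime → S1.W1NPrint p → ∀ n : ℕ, n ≤ 4 → S1.LocalKillTame p n)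
    (hG : ∀ p : ℕ, p.Prime → (∀ n : ℕ, n ≤ 4 → S1.LocalKillTame p n) → S1.GlobalKillTame p)
    (hT : ∀ p : ℕ, p.Prime → S1.GlobalKillTame p → S1.GlobalKillBR p)
    (hBR : BerghRydh2019_diagonalizableQuotientResolution)
    (hA : BerghRydh2019_diagonalizableQuotientResolution →
      ∀ p : ℕ, p.Prime → S1.GlobalKillBR p → S1.CyclicQuotientAt p) :
    Summit.ResolutionOfSingularities.ResolutionOfSingularities.Theses.WildQuotients.CyclicQuotientFourfolds :=
  fun p hp => hA hBR p hp (hT p hp (hG p hp (fun n hn => hL p hp (hW p hp) n hn)))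

end Summit.ResolutionOfSingularities.ResolutionOfSingularities.Cruxes.CyclicQuotientFourfolds.S1aTameBR
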